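import Summits.Ventures.PercRepro.RankLevelSetLevelSixHeavySq25Free
import Summits.Ventures.PercRepro.RankLevelSetLevelSixHeavySq25Mid
import Summits.Ventures.PercRepro.RankLevelSetLevelSixHeavySq25Hi
import Summits.Ventures.PercRepro.RankLevelSetLevelSixHeavySq25Par
import Summits.Ventures.PercRepro.RankLevelSetLevelSixHeavySq24S
import Summits.Ventures.PercRepro.RankLevelSetLevelSixHeavySq23S
import Summits.Ventures.PercRepro.RankLevelSetCoreSixLowSelfDJ
import Summits.Ventures.PercRepro.RankLevelSetLevelSixHeavySq26All
import Summits.Ventures.PercRepro.S2CoreSeventeenSplit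
import Summits.Ventures.PercRepro.S3SixWindow

/-!
# PercRepro — THEOREM C₆ AT RANK `25` BY THE TWO-LEVEL COLOOP SPLIT: LEVEL `5` AT `24` ⇒ C-025 AT LEVEL `6` FOR EVERY `p ≥ 25` (p8 g9, S3)

`proofs/SUBCLAIM-S3-p8.md` §3w (THE 25 ROW). The core cells of rank `25`: at `7 ≤ d ≤ 14` by the TWO-LEVEL COLOOP SPLIT — a core with no coloop by the coloop-free cells on the corrected cell (`c025_core_six_bounded_corank_heavy_sq25_free`); a core with a coloop `e` by the scaled cell `(Φ(25, 6)/2)·#U ≤ #Y` on `M ∖ e` (rank `24`, the same corank), itself by the coloop-free scaled cells (`c025_core_six_scaled_heavy_sq24s`) or, for a coloop `e'` of `M ∖ e`, by the twice-scaled cell `(Φ(25, 6)/4)·#U ≤ #Y` on `M ∖ e ∖ e'` (rank `23`, every core: `c025_core_six_scaled2_heavy_sq23s`) through p7's `weighted_of_isColoop_scaled` (S2CoreSeventeenSplit) and `RLS_of_coloop_scaled`; at `15 ≤ d ≤ 53` by the cells `_mid` / `_hi` for EVERY core (nullity-only caps), the parity cell `d = 24` by `c025_core_six_parity_heavy_sq25`;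 at `d ≥ 54` by the corank regime `c025_core_six_thirtynine_twenty_five'` (RankLevelSetCoreSixLowSelfDJ). Level `5` at `24` gives level `6` at `25` (`rls_six_at_of_core`); `p ≥ 26` is the `26` row `c025_six_large_twenty_six` (RankLevelSetLevelSixHeavySq26All). Axioms: standard.
-/

open scoped Matroid

namespace PercRepro

namespace ThmN

open Set

variable {α : Type}

/-- **The scaled cell `(Φ(25, 6)/2)·#U(24, 6) ≤ #Y(24, 6)` on EVERY `e`-free core of rank `24`, corank `7 ≤ d ≤ 14`** — level one of the split:
no coloop by the coloop-free scaled cells, a coloop `e'` by the twice-scaled cell on `M ∖ e'` at rank `23` and `weighted_of_isColoop_scaled`. -/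
theorem c025_core_six_scaled_heavy_sq24_all (M : Matroid α) [M.Finite] (d : ℕ) (hd7 : 7 ≤ d) (hd14 : d ≤ 14)
    (hR : M.eRank = (24 : ℕ∞)) (hn : M.E.ncard = 24 + d)
    (hfree : ∀ e ∈ M.E, ∃ A ⊆ M.E \ {e}, e ∉ M.closure A ∧ e ∉ M.closure ((M.E \ {e}) \ A)) :
    phiK (24 + 1) 6 / 2 * (Matroid.topCount M 24 6 : ℚ) ≤ (Matroid.midCount M 24 6 : ℚ) := by
  by_cases hc : ∃ e ∈ M.E, M.IsColoop e
  · obtain ⟨e, _, hce⟩ := hc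
    have hR' : M.eRank = ((23 + 1 : ℕ) : ℕ∞) := by rw [hR]; norm_num
    obtain ⟨hn23, hR23, hfree23, -⟩ := delete_core_data M hce hR' (by omega) hfree
    have h := c025_core_six_scaled2_heavy_sq23s (M ＼ {e}) 23 d (le_refl 23) hd7 hd14 hR23 hn23 hfree23
    have h' : phiK (24 + 1) 6 / 2 / 2 * (Matroid.topCount (M ＼ {e}) 23 6 : ℚ) ≤
        (Matroid.midCount (M ＼ {e}) 23 6 : ℚ) := by
      have e1 : phiK (24 + 1) 6 / 2 / 2 = phiK (23 + 2) 6 / 4 := by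
        rw [show (24 + 1 : ℕ) = 23 + 2 by norm_num]; ring
      rw [e1]; exact h
    exact weighted_of_isColoop_scaled M hce (by norm_num) hR' (phiK (24 + 1) 6 / 2) h'
  · exact c025_core_six_scaled_heavy_sq24s M 24 d (le_refl 24) hd7 hd14 (fun e he hce => hc ⟨e, he, hce⟩) hR hn hfree

/-- **The core cell `(25, d)` at `7 ≤ d ≤ 14`, every `e`-free core, by the two-level coloop split.** -/
theorem c025_core_six_twentyfive_small (M : Matroid α) [M.Finite] (d : ℕ) (hd7 : 7 ≤ d) (hd14 : d ≤ 14)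
    (hR : M.eRank = (25 : ℕ∞)) (hn : M.E.ncard = 25 + d)
    (hfree : ∀ e ∈ M.E, ∃ A ⊆ M.E \ {e}, e ∉ M.closure A ∧ e ∉ M.closure ((M.E \ {e}) \ A)) :
    RLS M 25 6 := by
  by_cases hc : ∃ e ∈ M.E, M.IsColoop e
  · obtain ⟨e, _, hce⟩ := hc
    have hR' : M.eRank = ((24 + 1 : ℕ) : ℕ∞) := by rw [hR]; norm_num
    obtain ⟨hn24, hR24, hfree24, -⟩ := delete_core_data M hce hR' (by omega) hfree
    exact RLS_of_coloop_scaled M hce (by norm_num) hR'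
      (c025_core_six_scaled_heavy_sq24_all (M ＼ {e}) d hd7 hd14 hR24 hn24 hfree24)
  · exact c025_core_six_bounded_corank_heavy_sq25_free M 25 d (le_refl 25) hd7 hd14 (fun e he hce => hc ⟨e, he, hce⟩) hR hn hfree

/-- **The core cell `(25, d)` at every corank `d ≥ 7`, every `e`-free core.** -/
theorem c025_core_six_twentyfive (M : Matroid α) [M.Finite] (d : ℕ) (hd7 : 7 ≤ d)
    (hR : M.eRank = (25 : ℕ∞)) (hn : M.E.ncard = 25 + d)
    (hfree : ∀ e ∈ M.E, ∃ A ⊆ M.E \ {e}, e ∉ M.closure A ∧ e ∉ M.closure ((M.E \ {e}) \ A)) :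
    RLS M 25 6 := by
  rcases Nat.lt_or_ge d 15 with h14 | h15
  · exact c025_core_six_twentyfive_small M d hd7 (by omega) hR hn hfree
  rcases Nat.lt_or_ge d 32 with h31 | h32
  · by_cases h24 : d = 24
    · subst h24
      exact c025_core_six_parity_heavy_sq25 M 25 (le_refl 25) hR hn hfree
    · exact c025_core_six_bounded_corank_heavy_sq25_mid M 25 d (le_refl 25) h15 (by omega) h24 hR hn hfree
  rcases Nat.lt_or_ge d 54 with h53 | h54
  · exact c025_core_six_bounded_corank_heavy_sq25_hi M 25 d (le_refl 25) h32 (by omega) hR hn hfree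
  · exact c025_core_six_thirtynine_twenty_five' M 25 (le_refl 25) hR (by omega) hfree

/-- **THEOREM C₆ AT RANK `25` BY THE TWO-LEVEL COLOOP SPLIT, GIVEN LEVEL `5`**: level `5` for all `p ≥ 24` implies level `6` for all
`p ≥ 25` (`p = 25` by the core cells above and `rls_six_at_of_core`; `p ≥ 26` by the `26` row). -/
theorem c025_six_of_five_heavy_sq25 (h5 : ∀ (M : Matroid α) [M.Finite] (p : ℕ), 24 ≤ p → RLS M p 5) :
    ∀ (M : Matroid α) [M.Finite] (p : ℕ), 25 ≤ p → RLS M p 6 := by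
  intro M _ p hp
  rcases Nat.lt_or_ge p 26 with hlt | hge
  · have hP : p = 25 := by omega
    subst hP
    refine rls_six_at_of_core 25 (by norm_num) (fun M _ => h5 M 24 (by norm_num)) ?_ M
    intro M _ d hd hR hn hfree
    exact c025_core_six_twentyfive M d hd hR hn hfree
  · exact c025_six_large_twenty_six M p hge

end ThmN

end PercRepro
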